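import Literature.NumberTheory.LFunctions.BernoulliGammaTransformIdentity
import Literature.NumberTheory.LFunctions.SinnottGammaTransformNonvanishing
import Mathlib.RingTheory.Valuation.ValuationSubring
import Mathlib.RingTheory.LocalRing.ResidueField.Basic
import Mathlib.Algebra.CharP.Lemmas
import Mathlib.FieldTheory.Finite.Basic
import HarnessLib

/-!
# Washington's theorem (after Sinnott): `B_{n,λψ}/n` is a `p`-adic unit for almost all `ψ`

Topic `Literature/NumberTheory/LFunctions`; namespace `Literature.NumberTheory.LFunctions`.
THEOREMS ONLY (auxiliary `def`s with bodies; no named facts).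

Let `K` be a field of characteristic `0` with a valuation `v` such that `v(p) < 1` for a prime
`p ≠ 2`, let `M ≠ p` be a prime, `λ'` a Dirichlet character modulo `f` with `M ∣ f` and
`λ'(-1) = (-1)^n` (`n ≥ 1`), all values in `K`, and assume `K` contains primitive `m`-th roots of
unity for all `m`.  Then there is `r₀` such that for all `r ≥ r₀` and all PRIMITIVE Dirichlet
characters `φ` modulo `M^r` "of the second kind" (trivial exactly on the torsion `V` of
`(ℤ/M^r)ˣ`), the generalized Bernoulli number of `Λ = λ' φ̄` satisfies `v(B_{n,Λ}/n) = 1`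
(`washington_sinnott_valuation_eq_one`).  This is Washington's theorem [Was78] in the
quantitative-free form proved by Sinnott [Sinnott1987, Theorem 4.4 and §4.5] (there for `n = 1`;
the same proof works for all `n`): by `gaussSum_mul_generalizedBernoulli`,
`g(φ) B_{n,Λ} = n ∑_b φ(b) Q_{n-1}(ζ^b)/((ζ^b)^f - 1)^n`; the right-hand side is `v`-integral and
its reduction in the residue field `k` of `v` is `∑_c ψ̄(c) r̄(ζ̄^c)` for the rational function
`r̄ = Q̄_{n-1}/(Z^f-1)^n` over a finite subfield `F = {x : x^q = x} ⊆ k`, which is non-zero for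
`r ≥ m₀` by Sinnott's Theorem 3.2 (`sinnott_sum_psi_ratFn_ne_zero`), the support and symmetry
hypotheses being the polynomial identities `sum_qpoly_comp_eq_zero` and `reflect_qpoly`.

## References

* L. C. Washington, *The non-`p`-part of the class number in a cyclotomic `ℤ_p`-extension*,
  Invent. Math. 49 (1978), 87–97. [Washington1978]
* W. Sinnott, *On a theorem of L. Washington*, Astérisque 147–148 (1987), 209–224, Theorem 4.4,
  Proposition 4.6, §4.5. [Sinnott1987]
-/

noncomputable section

open Finset

namespace Literature.NumberTheory.LFunctions

open Sinnott1987

/-! ### Valuation-ring facts -/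

section ValuationFacts

variable {K : Type*} [Field K] {Γ₀ : Type*} [LinearOrderedCommGroupWithZero Γ₀] (v : Valuation K Γ₀)

/-- `v(n) ≤ 1` for natural numbers `n`. [folklore] -/
theorem valuation_natCast_le_one (n : ℕ) : v (n : K) ≤ 1 := by
  induction n with
  | zero => simp
  | succ n ih =>
    rw [Nat.cast_succ]
    exact (v.map_add_le_max' _ _).trans (max_le ih (le_of_eq v.map_one))

/-- `v(a) ≤ 1` for integers `a`. [folklore] -/
theorem valuation_intCast_le_one (a : ℤ) : v (a : K) ≤ 1 := by
  obtain ⟨n, rfl | rfl⟩ := Int.eq_nat_or_neg a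
  · rw [Int.cast_natCast]; exact valuation_natCast_le_one v n
  · rw [Int.cast_neg, Int.cast_natCast, Valuation.map_neg]; exact valuation_natCast_le_one v n

/-- If `v(p) < 1`, then `v(M) = 1` for every natural number `M` coprime to `p`. [folklore] -/
theorem valuation_eq_one_of_coprime {p M : ℕ} (hp : v (p : K) < 1) (hMp : M.Coprime p) :
    v (M : K) = 1 := by
  refine le_antisymm (valuation_natCast_le_one v M) ?_
  by_contra hlt
  rw [not_le] at hlt
  obtain ⟨a, b, hab⟩ := (Nat.isCoprime_iff_coprime.mpr hMp : IsCoprime (M : ℤ) (p : ℤ))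
  have h1 : v ((a * M + b * p : ℤ) : K) = 1 := by rw [hab, Int.cast_one, map_one]
  have h2 : v ((a * M + b * p : ℤ) : K) < 1 := by
    push_cast
    refine v.map_add_lt ?_ ?_
    · rw [map_mul]
      exact mul_lt_one_of_nonneg_of_lt_one_right (valuation_intCast_le_one v a) zero_le hlt
    · rw [map_mul]
      exact mul_lt_one_of_nonneg_of_lt_one_right (valuation_intCast_le_one v b) zero_le hp
  exact h2.ne h1

/-- `v(η) = 1` for a root of unity `η`. [folklore] -/
theorem valuation_eq_one_of_pow_eq_one {η : K} {N : ℕ} (hN : N ≠ 0) (h : η ^ N = 1) : v η = 1 := by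
  have hv : v η ^ N = 1 := by rw [← map_pow, h, map_one]
  rcases lt_trichotomy (v η) 1 with hlt | heq | hgt
  · exact absurd hv (pow_lt_one₀ zero_le hlt hN).ne
  · exact heq
  · exact absurd hv (one_lt_pow₀ hgt hN).ne'

/-- Units of the valuation ring are the elements of valuation `1`. [folklore] -/
theorem isUnit_iff_valuation_eq_one (x : v.valuationSubring) : IsUnit x ↔ v (x : K) = 1 := by
  constructor
  · rintro ⟨u, rfl⟩
    have h1 : v ((u : v.valuationSubring) : K) *
        v (((u⁻¹ : v.valuationSubringˣ) : v.valuationSubring) : K) = 1 := by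
      have h := congrArg (algebraMap v.valuationSubring K) u.mul_inv
      rw [map_mul, map_one, ValuationSubring.algebraMap_apply, ValuationSubring.algebraMap_apply] at h
      rw [← map_mul, h, map_one]
    have hle : v ((u : v.valuationSubring) : K) ≤ 1 :=
      (Valuation.mem_valuationSubring_iff v _).mp (u : v.valuationSubring).2
    have hle' : v (((u⁻¹ : v.valuationSubringˣ) : v.valuationSubring) : K) ≤ 1 :=
      (Valuation.mem_valuationSubring_iff v _).mp ((u⁻¹ : v.valuationSubringˣ) : v.valuationSubring).2
    refine le_antisymm hle (not_lt.mp fun hlt ↦ ?_)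
    exact (mul_lt_one_of_nonneg_of_lt_one_left zero_le hlt hle').ne h1
  · intro hx
    have hx0 : (x : K) ≠ 0 := fun h ↦ by rw [h, map_zero] at hx; exact zero_ne_one hx
    have hinv : (x : K)⁻¹ ∈ v.valuationSubring := by
      rw [Valuation.mem_valuationSubring_iff, map_inv₀, hx, inv_one]
    exact IsUnit.of_mul_eq_one ⟨(x : K)⁻¹, hinv⟩ (Subtype.ext (mul_inv_cancel₀ hx0))

/-- Non-units of the valuation ring have valuation `< 1`. [folklore] -/
theorem valuation_lt_one_iff_not_isUnit (x : v.valuationSubring) : v (x : K) < 1 ↔ ¬ IsUnit x := by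
  rw [isUnit_iff_valuation_eq_one]
  have hle : v (x : K) ≤ 1 := (Valuation.mem_valuationSubring_iff v _).mp x.2
  exact ⟨fun h ↦ h.ne, fun h ↦ lt_of_le_of_ne hle h⟩

/-- The residue field of `v` has characteristic `p` when `v(p) < 1`. [folklore] -/
theorem charP_residueField {p : ℕ} [hp : Fact p.Prime] (hvp : v (p : K) < 1) :
    CharP (IsLocalRing.ResidueField v.valuationSubring) p := by
  refine (CharP.charP_iff_prime_eq_zero hp.out).mpr ?_
  have h : ¬ IsUnit ((p : ℕ) : v.valuationSubring) :=
    (valuation_lt_one_iff_not_isUnit v _).mp (by exact_mod_cast hvp)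
  rw [← map_natCast (IsLocalRing.residue v.valuationSubring), IsLocalRing.residue_eq_zero_iff]
  exact (IsLocalRing.mem_maximalIdeal _).mpr h

/-- **Roots of unity of order prime to the residue characteristic reduce injectively**: if
`ξ^N = 1`, `N ≠ 0` in the residue field and `ξ ≡ 1`, then `ξ = 1`. [folklore] -/
theorem eq_one_of_pow_eq_one_of_residue {N : ℕ}
    (hN : (N : IsLocalRing.ResidueField v.valuationSubring) ≠ 0) {ξ : v.valuationSubring}
    (hξ : ξ ^ N = 1) (hred : IsLocalRing.residue v.valuationSubring ξ = 1) : ξ = 1 := by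
  have hgeom : (∑ i ∈ range N, ξ ^ i) * (ξ - 1) = 0 := by rw [geom_sum_mul, hξ, sub_self]
  have hunit : IsUnit (∑ i ∈ range N, ξ ^ i) := by
    rw [← IsLocalRing.residue_ne_zero_iff_isUnit, map_sum]
    simp only [map_pow, hred, one_pow, sum_const, card_range, nsmul_eq_mul, mul_one]
    exact hN
  have := (hunit.mul_right_eq_zero).mp hgeom
  rwa [sub_eq_zero] at this

/-- `ξ - 1` is a unit for a root of unity `ξ ≠ 1` of order prime to the residue characteristic.
[folklore] -/
theorem isUnit_sub_one_of_pow_eq_one {N : ℕ}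
    (hN : (N : IsLocalRing.ResidueField v.valuationSubring) ≠ 0) {ξ : v.valuationSubring}
    (hξ : ξ ^ N = 1) (hne : ξ ≠ 1) : IsUnit (ξ - 1) := by
  by_contra h
  apply hne
  refine eq_one_of_pow_eq_one_of_residue v hN hξ ?_
  have h0 : IsLocalRing.residue v.valuationSubring (ξ - 1) = 0 :=
    (IsLocalRing.residue_eq_zero_iff _).mpr ((IsLocalRing.mem_maximalIdeal _).mpr h)
  rwa [map_sub, map_one, sub_eq_zero] at h0

/-- The reduction of a root of unity `ξ ≠ 1` of order prime to the residue characteristic is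
`≠ 1`. [folklore] -/
theorem residue_ne_one_of_pow_eq_one {N : ℕ}
    (hN : (N : IsLocalRing.ResidueField v.valuationSubring) ≠ 0) {ξ : v.valuationSubring}
    (hξ : ξ ^ N = 1) (hne : ξ ≠ 1) : IsLocalRing.residue v.valuationSubring ξ ≠ 1 :=
  fun h ↦ hne (eq_one_of_pow_eq_one_of_residue v hN hξ h)

/-- **Primitive `M^m`-th roots of unity stay primitive in the residue field** (`M ≠ 0` there).
[folklore] -/
theorem isPrimitiveRoot_residue {M : ℕ} [hM : Fact M.Prime]
    (hMk : (M : IsLocalRing.ResidueField v.valuationSubring) ≠ 0) {m : ℕ} (hm : 1 ≤ m)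
    {ξ : v.valuationSubring} (hξ : IsPrimitiveRoot ξ (M ^ m)) :
    IsPrimitiveRoot (IsLocalRing.residue v.valuationSubring ξ) (M ^ m) := by
  obtain ⟨j, rfl⟩ : ∃ j, m = j + 1 := ⟨m - 1, by omega⟩
  have hpow : IsLocalRing.residue v.valuationSubring ξ ^ M ^ (j + 1) = 1 := by
    rw [← map_pow, hξ.pow_eq_one, map_one]
  have hnot : ¬ IsLocalRing.residue v.valuationSubring ξ ^ M ^ j = 1 := by
    rw [← map_pow]
    refine residue_ne_one_of_pow_eq_one v (N := M) hMk ?_ ?_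
    · rw [← pow_mul, ← pow_succ, hξ.pow_eq_one]
    · intro h
      have := hξ.pow_eq_one_iff_dvd (M ^ j) |>.mp h
      exact absurd (Nat.le_of_dvd (pow_pos hM.out.pos _) this)
        (not_le.mpr (Nat.pow_lt_pow_right hM.out.one_lt (Nat.lt_succ_self j)))
  have horder := orderOf_eq_prime_pow hnot hpow
  rw [← horder]
  exact IsPrimitiveRoot.orderOf _

end ValuationFacts

/-! ### The finite field `F = {x : x^q = x}` of a field of characteristic `p` -/

section FrobFixed

variable (k : Type*) [Field k] (p : ℕ) [hp : Fact p.Prime] [CharP k p]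

/-- The subfield of elements fixed by `x ↦ x^{p^d}`. [folklore] -/
def frobFixed (d : ℕ) : Subfield k where
  carrier := {x | x ^ p ^ d = x}
  mul_mem' {a b} ha hb := by
    simp only [Set.mem_setOf_eq] at ha hb ⊢
    rw [mul_pow, ha, hb]
  one_mem' := by simp
  add_mem' {a b} ha hb := by
    simp only [Set.mem_setOf_eq] at ha hb ⊢
    rw [add_pow_char_pow, ha, hb]
  zero_mem' := by
    simp only [Set.mem_setOf_eq]
    exact zero_pow (pow_ne_zero _ hp.out.ne_zero)
  neg_mem' {a} ha := by
    simp only [Set.mem_setOf_eq] at ha ⊢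
    rw [neg_pow, ha, neg_one_pow_char_pow, neg_one_mul]
  inv_mem' a ha := by
    simp only [Set.mem_setOf_eq] at ha ⊢
    rw [inv_pow, ha]

/-- Membership in `frobFixed`. [folklore] -/
theorem mem_frobFixed_iff {d : ℕ} (x : k) : x ∈ frobFixed k p d ↔ x ^ p ^ d = x := Iff.rfl

/-- Every element `c` of `F = frobFixed k p d` satisfies `c^q = c`, `q = p^d`. [folklore] -/
theorem frobFixed_pow_eq (d : ℕ) (c : frobFixed k p d) : c ^ p ^ d = c :=
  Subtype.ext (by rw [SubmonoidClass.coe_pow]; exact c.2)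

end FrobFixed

/-! ### Choice of `q = p^d` -/

section GoodPower

variable {k : Type*} [Field k] {p : ℕ} [hp : Fact p.Prime] [CharP k p] {M : ℕ} [hM : Fact M.Prime]

/-- In characteristic `p`, `x^{p^s N₀} = 1` forces `x^{N₀} = 1`. [folklore] -/
theorem pow_eq_one_of_pow_pow_mul_eq_one {x : k} {s N₀ : ℕ} (h : x ^ (p ^ s * N₀) = 1) :
    x ^ N₀ = 1 := by
  have h1 : (x ^ N₀ - 1) ^ p ^ s = 0 := by
    rw [sub_pow_char_pow, one_pow, ← pow_mul, mul_comm, h, sub_self]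
  exact sub_eq_zero.mp (pow_eq_zero_iff (pow_ne_zero _ hp.out.ne_zero) |>.mp h1)

/-- **Choice of `q`.**  Given `N ≠ 0`, there is `d ≥ 1` such that `q = p^d` satisfies
`M ∣ q - 1`, `4 ∣ q - 1` and `x^q = x` for every `x` with `x^N = 1` (`p ≠ 2`, `M ≠ p`). [folklore] -/
theorem exists_goodModulus_pow (hMp : M ≠ p) (hp2 : p ≠ 2) {N : ℕ} (hN : N ≠ 0) :
    ∃ d : ℕ, 1 ≤ d ∧ GoodModulus M (p ^ d) ∧ ∀ x : k, x ^ N = 1 → x ^ p ^ d = x := by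
  obtain ⟨s, N₀, hN₀, hNeq⟩ := Nat.exists_eq_pow_mul_and_not_dvd hN p hp.out.ne_one
  have hN₀0 : N₀ ≠ 0 := by rintro rfl; exact hN (by rw [hNeq, mul_zero])
  set L := N₀ * (4 * M) with hL
  have hL0 : L ≠ 0 := mul_ne_zero hN₀0 (mul_ne_zero (by norm_num) hM.out.ne_zero)
  have hcop : p.Coprime L := by
    rw [hL]
    refine Nat.Coprime.mul_right ((Nat.Prime.coprime_iff_not_dvd hp.out).mpr hN₀)
      (Nat.Coprime.mul_right ?_ ?_)
    · have : p.Coprime 2 := (Nat.coprime_primes hp.out Nat.prime_two).mpr hp2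
      simpa using this.pow_right 2
    · exact (Nat.coprime_primes hp.out hM.out).mpr (Ne.symm hMp)
  set d := Nat.totient L with hd
  have hd1 : 1 ≤ d := Nat.totient_pos.mpr (Nat.pos_of_ne_zero hL0)
  have hmod : p ^ d ≡ 1 [MOD L] := Nat.ModEq.pow_totient hcop
  have hq1 : 1 ≤ p ^ d := Nat.one_le_pow _ _ hp.out.pos
  have hLdvd : L ∣ p ^ d - 1 := (Nat.modEq_iff_dvd' hq1).mp hmod.symm
  refine ⟨d, hd1, ⟨?_, ?_, ?_⟩, ?_⟩
  · exact Nat.one_lt_pow (by omega) hp.out.one_lt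
  · exact dvd_trans ⟨N₀ * 4, by rw [hL]; ring⟩ hLdvd
  · intro _; exact dvd_trans ⟨N₀ * M, by rw [hL]; ring⟩ hLdvd
  · intro x hx
    rw [hNeq] at hx
    have hx0 := pow_eq_one_of_pow_pow_mul_eq_one hx
    have hN₀dvd : N₀ ∣ p ^ d - 1 := dvd_trans ⟨4 * M, by rw [hL]⟩ hLdvd
    obtain ⟨t, ht⟩ := hN₀dvd
    calc x ^ p ^ d = x ^ (p ^ d - 1) * x := by rw [← pow_succ, Nat.sub_add_cancel hq1]
      _ = x := by rw [ht, pow_mul, hx0, one_pow, one_mul]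

end GoodPower

/-! ### Washington's theorem -/

section Main

variable {K : Type*} [Field K] [CharZero K] {Γ₀ : Type*} [LinearOrderedCommGroupWithZero Γ₀]
  (v : Valuation K Γ₀) {p : ℕ} [hp : Fact p.Prime] {M : ℕ} [hM : Fact M.Prime]

omit [CharZero K] in
/-- Values of a Dirichlet character have valuation `≤ 1` (they are `0` or roots of unity). [folklore] -/
theorem valuation_apply_le_one {N : ℕ} [NeZero N] (χ : DirichletCharacter K N) (c : ZMod N) :
    v (χ c) ≤ 1 := by
  by_cases hc : IsUnit c
  · obtain ⟨u, rfl⟩ := hc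
    refine le_of_eq (valuation_eq_one_of_pow_eq_one v (Fintype.card_ne_zero (α := (ZMod N)ˣ)) ?_)
    rw [← MulChar.coe_toUnitHom, ← Units.val_pow_eq_pow_val, ← map_pow, pow_card_eq_one, map_one,
      Units.val_one]
  · rw [MulChar.map_nonunit _ hc, map_zero]; exact zero_le

omit [CharZero K] in
/-- On units, a Dirichlet character value raised to the group order is `1`. [folklore] -/
theorem apply_pow_card_eq_one {N : ℕ} [NeZero N] (χ : DirichletCharacter K N) (u : (ZMod N)ˣ) :
    χ u ^ Fintype.card (ZMod N)ˣ = 1 := by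
  rw [← MulChar.coe_toUnitHom, ← Units.val_pow_eq_pow_val, ← map_pow, pow_card_eq_one, map_one,
    Units.val_one]

/-- **Washington's theorem** (Sinnott's form, for all `n ≥ 1`).  Let `v` be a valuation on a field
`K` of characteristic `0` with `v(p) < 1` (`p ≠ 2` prime), `M ≠ p` a prime, `λ'` a Dirichlet
character modulo `f` with `M ∣ f` and `λ'(-1) = (-1)^n`, and suppose `K` contains primitive roots
of unity of all orders.  Then for all large `r` and every primitive Dirichlet character `φ`
modulo `M^r` whose kernel on `(ℤ/M^r)ˣ` is exactly the torsion subgroup `V`, the generalized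
Bernoulli number of `Λ = λ' φ̄` (modulo `f M^r`) satisfies `v(B_{n,Λ}/n) = 1`.
[cite: Sinnott1987, Theorem 4.4 and §4.5 (with Prop. 4.6); Washington1978, Theorem] -/
theorem washington_sinnott_valuation_eq_one (hvp : v (p : K) < 1) (hMp : M ≠ p) (hp2 : p ≠ 2)
    (hroots : ∀ m : ℕ, 0 < m → ∃ ζ : K, IsPrimitiveRoot ζ m)
    {f : ℕ} [NeZero f] (hMf : M ∣ f) (θ : DirichletCharacter K f) {n : ℕ} (hn : 1 ≤ n)
    (hpar : θ (-1) = (-1) ^ n) :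
    ∃ r₀ : ℕ, ∀ r : ℕ, r₀ ≤ r → ∀ φ : DirichletCharacter K (M ^ r), φ.IsPrimitive →
      (∀ u : (ZMod (M ^ r))ˣ, IsTors u → φ u = 1) → (∀ u : (ZMod (M ^ r))ˣ, φ u = 1 → IsTors u) →
        v (generalizedBernoulli n
            (DirichletCharacter.changeLevel (dvd_mul_right f (M ^ r)) θ *
              DirichletCharacter.changeLevel (dvd_mul_left (M ^ r) f) φ⁻¹) / n) = 1 := by
  classical
  obtain ⟨k₁, rfl⟩ : ∃ k₁, n = k₁ + 1 := ⟨n - 1, by omega⟩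
  -- the valuation ring, its residue field `k` (characteristic `p`), the reduction map
  set O := v.valuationSubring with hOdef
  haveI hchar : CharP (IsLocalRing.ResidueField O) p := charP_residueField v hvp
  have hpM : ¬ p ∣ M := fun h ↦ hMp ((Nat.prime_dvd_prime_iff_eq hp.out hM.out).mp h).symm
  have hMk : (M : IsLocalRing.ResidueField O) ≠ 0 := fun h ↦
    hpM ((CharP.cast_eq_zero_iff (IsLocalRing.ResidueField O) p M).mp h)
  have hMpowk : ∀ j : ℕ, ((M ^ j : ℕ) : IsLocalRing.ResidueField O) ≠ 0 := fun j ↦ by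
    rw [Nat.cast_pow]; exact pow_ne_zero _ hMk
  have hf0 : f ≠ 0 := NeZero.ne f
  have hf2 : 2 ≤ f := le_trans hM.out.two_le (Nat.le_of_dvd (Nat.pos_of_ne_zero hf0) hMf)
  -- the values of `θ` in `O` and in `k`
  set aO : ℕ → O := fun c ↦ ⟨θ (c : ZMod f), valuation_apply_le_one v θ _⟩ with haO
  set aK : ℕ → IsLocalRing.ResidueField O := fun c ↦ IsLocalRing.residue O (aO c) with haK
  have haOK : ∀ c, ((aO c : O) : K) = θ (c : ZMod f) := fun c ↦ rfl
  -- choice of `q = p^d`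
  obtain ⟨d, hd1, hq, hfix⟩ := exists_goodModulus_pow (k := IsLocalRing.ResidueField O) hMp hp2
    (Fintype.card_ne_zero (α := (ZMod f)ˣ))
  set q := p ^ d with hqdef
  have haKq : ∀ c, aK c ^ q = aK c := by
    intro c
    by_cases hc : IsUnit (c : ZMod f)
    · obtain ⟨u, hu⟩ := hc
      refine hfix _ ?_
      rw [haK]; simp only
      rw [← map_pow, ← map_one (IsLocalRing.residue O)]
      congr 1
      apply Subtype.ext
      rw [SubmonoidClass.coe_pow, haOK, ← hu, apply_pow_card_eq_one]
      rfl
    · have : aO c = 0 := Subtype.ext (by rw [haOK, MulChar.map_nonunit _ hc]; rfl)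
      rw [haK]; simp only
      rw [this, map_zero, zero_pow (pow_ne_zero _ hp.out.ne_zero)]
  have hq1 : 1 ≤ q := hq.one_lt.le
  -- `n₀ = v_M(q-1)` and a primitive `M^{n₀}`-th root of unity in the residue field
  set n₀ := padicValNat M (q - 1) with hn₀def
  have hn₀1 : 1 ≤ n₀ := hq.one_le_padicValNat
  obtain ⟨ξ, hξ⟩ := hroots (M ^ n₀) (pow_pos hM.out.pos _)
  have hξv : v ξ = 1 := valuation_eq_one_of_pow_eq_one v (pow_ne_zero _ hM.out.ne_zero) hξ.pow_eq_one
  set ξO : O := ⟨ξ, hξv.le⟩ with hξOdef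
  have hξO : IsPrimitiveRoot ξO (M ^ n₀) :=
    IsPrimitiveRoot.of_map_of_injective (f := algebraMap O K) (by exact hξ) (IsFractionRing.injective O K)
  set εk := IsLocalRing.residue O ξO with hεkdef
  have hεk : IsPrimitiveRoot εk (M ^ n₀) := isPrimitiveRoot_residue v hMk hn₀1 hξO
  have hεkF : εk ∈ frobFixed (IsLocalRing.ResidueField O) p d := by
    rw [mem_frobFixed_iff]
    obtain ⟨t, ht⟩ : M ^ n₀ ∣ q - 1 := pow_padicValNat_dvd
    calc εk ^ p ^ d = εk ^ (q - 1) * εk := by rw [← pow_succ, Nat.sub_add_cancel hq1]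
      _ = εk := by rw [ht, pow_mul, hεk.pow_eq_one, one_pow, one_mul]
  -- the finite field `F`
  set F := frobFixed (IsLocalRing.ResidueField O) p d with hFdef
  have hFq : ∀ c : F, c ^ q = c := frobFixed_pow_eq _ p d
  have haKF : ∀ c, aK c ∈ F := fun c ↦ (mem_frobFixed_iff _ p _).mpr (haKq c)
  set aF : ℕ → F := fun c ↦ ⟨aK c, haKF c⟩ with haF
  have haFk : ∀ c, algebraMap F (IsLocalRing.ResidueField O) (aF c) = aK c := fun c ↦ rfl
  have hεk0 : εk ≠ 0 := hεk.ne_zero (pow_ne_zero _ hM.out.ne_zero)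
  have hεF0 : (⟨εk, hεkF⟩ : F) ≠ 0 := fun h ↦ hεk0 (congrArg Subtype.val h)
  set ε₁ : Fˣ := Units.mk0 ⟨εk, hεkF⟩ hεF0 with hε₁def
  have hε₁k : algebraMap F (IsLocalRing.ResidueField O) (ε₁ : F) = εk := rfl
  have hε₁ : IsPrimitiveRoot (ε₁ : F) (M ^ n₀) :=
    IsPrimitiveRoot.of_map_of_injective (f := algebraMap F (IsLocalRing.ResidueField O))
      (by rw [hε₁k]; exact hεk) (algebraMap F _).injective
  -- basic facts on the values `aF`
  have haF_nonunit : ∀ c : ℕ, ¬ IsUnit (c : ZMod f) → aF c = 0 := by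
    intro c hc
    apply Subtype.ext
    show aK c = 0
    have : aO c = 0 := Subtype.ext (by rw [haOK, MulChar.map_nonunit _ hc]; rfl)
    rw [haK]; simp only; rw [this, map_zero]
  have haF_mul : ∀ c c' : ℕ, aF (c * c') = aF c * aF c' := by
    intro c c'
    apply Subtype.ext
    show aK (c * c') = aK c * aK c'
    have : aO (c * c') = aO c * aO c' := Subtype.ext (by
      rw [haOK]; push_cast; rw [map_mul])
    rw [haK]; simp only; rw [this, map_mul]
  have haF0 : aF 0 = 0 := by
    refine haF_nonunit 0 ?_
    rw [Nat.cast_zero, isUnit_zero_iff]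
    haveI : Fact (1 < f) := ⟨hf2⟩
    exact zero_ne_one
  have haF1 : aF 1 = 1 := by
    apply Subtype.ext
    show aK 1 = 1
    have : aO 1 = 1 := Subtype.ext (by rw [haOK, Nat.cast_one, map_one]; rfl)
    rw [haK]; simp only; rw [this, map_one]
  have haFdvd : ∀ c, M ∣ c → aF c = 0 := by
    intro c hc
    refine haF_nonunit c fun hu ↦ ?_
    rw [ZMod.isUnit_iff_coprime] at hu
    exact Nat.not_coprime_of_dvd_of_dvd hM.out.one_lt hc hMf hu
  -- `ε = aF (f-1)` is the image of `θ(-1) = (-1)^n`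
  have hneg1 : ((f - 1 : ℕ) : ZMod f) = -1 := by
    rw [Nat.cast_sub (by omega : 1 ≤ f), Nat.cast_one, ZMod.natCast_self, zero_sub]
  have haFε : aF (f - 1) = (-1) ^ (k₁ + 1) := by
    apply Subtype.ext
    show aK (f - 1) = (((-1) ^ (k₁ + 1) : F) : IsLocalRing.ResidueField O)
    have : aO (f - 1) = (-1) ^ (k₁ + 1) := Subtype.ext (by
      rw [haOK, hneg1, hpar]; simp)
    rw [haK]; simp only; rw [this, map_pow, map_neg, map_one]; simp
  have haFrefl : ∀ c, 0 < c → c < f → aF (f - c) = aF (f - 1) * aF c := by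
    intro c hc hcf
    rw [← haF_mul]
    apply Subtype.ext
    show aK (f - c) = aK ((f - 1) * c)
    have h1 : ((f - c : ℕ) : ZMod f) = (((f - 1) * c : ℕ) : ZMod f) := by
      rw [Nat.cast_mul, hneg1, Nat.cast_sub hcf.le, ZMod.natCast_self, zero_sub, neg_one_mul]
    have : aO (f - c) = aO ((f - 1) * c) := Subtype.ext (by rw [haOK, haOK, h1])
    rw [haK]; simp only; rw [this]
  -- the polynomials over `F`
  set fF : Polynomial F := qpoly (fun c ↦ aF c) f k₁ with hfFdef
  set gF : Polynomial F := (Polynomial.X ^ f - 1) ^ (k₁ + 1) with hgFdef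
  have hXf1 : (Polynomial.X ^ f - 1 : Polynomial F) ≠ 0 := by
    rw [← Polynomial.C_1]; exact Polynomial.X_pow_sub_C_ne_zero (by omega) _
  have hgF0 : gF ≠ 0 := pow_ne_zero _ hXf1
  have hfF0 : fF ≠ 0 := by
    intro h
    have := congrArg (fun P : Polynomial F ↦ P.coeff 1) h
    simp only [hfFdef, qpoly_coeff_one _ hf2, haF1, mul_one, Polynomial.coeff_zero] at this
    exact (pow_ne_zero _ (neg_ne_zero.mpr one_ne_zero)) this
  -- (Hsupp): `∑_{i<M} r̄(ζ₁^i Z) = 0`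
  set ζ₁ : F := (ε₁ : F) ^ M ^ (n₀ - 1) with hζ₁def
  have hζ₁ : IsPrimitiveRoot ζ₁ M :=
    hε₁.pow (pow_pos hM.out.pos _) (by rw [← pow_succ, Nat.sub_add_cancel hn₀1])
  have hζ₁f : ∀ i, (ζ₁ ^ i) ^ f = 1 := fun i ↦ by
    obtain ⟨t, ht⟩ := hMf
    rw [← pow_mul, ht, ← mul_assoc, mul_comm i M, mul_assoc, pow_mul, hζ₁.pow_eq_one, one_pow]
  have hunits : ∀ i, ((ε₁ ^ (M ^ (n₀ - 1) * i) : Fˣ) : F) = ζ₁ ^ i := fun i ↦ by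
    rw [Units.val_pow_eq_pow_val, pow_mul]
  have hsupp : ∑ i ∈ range M, scaleX (ε₁ ^ (M ^ (n₀ - 1) * i))
      (algebraMap (Polynomial F) (RatFunc F) fF / algebraMap (Polynomial F) (RatFunc F) gF) = 0 := by
    have hg : ∀ i, gF.comp (Polynomial.C (((ε₁ ^ (M ^ (n₀ - 1) * i) : Fˣ) : F)) * Polynomial.X) = gF := by
      intro i
      rw [hunits, hgFdef, Polynomial.pow_comp, Polynomial.sub_comp, Polynomial.X_pow_comp,
        Polynomial.one_comp, mul_pow, ← Polynomial.C_pow, hζ₁f, Polynomial.C_1, one_mul]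
    simp_rw [scaleX_div, hg, hunits]
    rw [← sum_div, ← map_sum, sum_qpoly_comp_eq_zero (fun c ↦ aF c) (by omega) hMf haFdvd
      hζ₁.pow_eq_one (fun c hc ↦ ?_) k₁, map_zero, zero_div]
    have hω : ζ₁ ^ c ≠ 1 := fun h ↦ hc ((hζ₁.pow_eq_one_iff_dvd c).mp h)
    rw [← sum_range_pow_eq_zero (by rw [← pow_mul, mul_comm, pow_mul, hζ₁.pow_eq_one, one_pow]) hω]
    exact sum_congr rfl fun i _ ↦ by rw [mul_comm, pow_mul]
  -- (N'): `r̄(Z) + r̄(Z⁻¹) = 2 r̄ ≠ 0`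
  have hN : algebraMap (Polynomial F) (RatFunc F) fF / algebraMap (Polynomial F) (RatFunc F) gF +
      invX (algebraMap (Polynomial F) (RatFunc F) fF / algebraMap (Polynomial F) (RatFunc F) gF) ≠ 0 := by
    haveI : Invertible (RatFunc.X : RatFunc F) := invertibleOfNonzero RatFunc.X_ne_zero
    have hX0 : (RatFunc.X : RatFunc F) ≠ 0 := RatFunc.X_ne_zero
    -- `ι(f̄) X^{f n} = ε f̄`
    have hdeg : fF.natDegree ≤ f * (k₁ + 1) := natDegree_qpoly_le _ (by omega) k₁
    have hrefl : Polynomial.reflect (f * (k₁ + 1)) fF = Polynomial.C (aF (f - 1)) * fF :=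
      reflect_qpoly _ (by omega) _ haF0 haFrefl k₁
    have hinvf : invX (algebraMap (Polynomial F) (RatFunc F) fF) * RatFunc.X ^ (f * (k₁ + 1)) =
        RatFunc.C ((-1) ^ (k₁ + 1)) * algebraMap (Polynomial F) (RatFunc F) fF := by
      have h := Polynomial.eval₂_reflect_mul_pow (algebraMap F (RatFunc F)) (RatFunc.X : RatFunc F)⁻¹
        (f * (k₁ + 1)) fF hdeg
      have hinvOf : ⅟((RatFunc.X : RatFunc F)⁻¹) = RatFunc.X := rfl
      rw [hinvOf, hrefl, Polynomial.eval₂_mul, Polynomial.eval₂_C, haFε, inv_pow] at h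
      rw [invX_algebraMap, Polynomial.aeval_def]
      -- h : C((-1)^n) * eval₂ _ X fF * (X^N)⁻¹ = eval₂ _ X⁻¹ fF
      have hXN : (RatFunc.X : RatFunc F) ^ (f * (k₁ + 1)) ≠ 0 := pow_ne_zero _ hX0
      rw [← h, mul_assoc, inv_mul_cancel₀ hXN, mul_one, ← Polynomial.aeval_def,
        RatFunc.aeval_X_left_eq_algebraMap, RatFunc.algebraMap_eq_C]
    have hgalg : algebraMap (Polynomial F) (RatFunc F) gF = (RatFunc.X ^ f - 1) ^ (k₁ + 1) := by
      rw [hgFdef, map_pow, map_sub, map_pow, RatFunc.algebraMap_X, map_one]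
    have hinvg : invX (algebraMap (Polynomial F) (RatFunc F) gF) * RatFunc.X ^ (f * (k₁ + 1)) =
        (-1) ^ (k₁ + 1) * algebraMap (Polynomial F) (RatFunc F) gF := by
      rw [hgalg, map_pow, map_sub, map_pow, invX_X, map_one, pow_mul, ← mul_pow, ← mul_pow]
      congr 1
      rw [sub_mul, inv_pow, inv_mul_cancel₀ (pow_ne_zero _ hX0)]
      ring
    have hXN : (RatFunc.X : RatFunc F) ^ (f * (k₁ + 1)) ≠ 0 := pow_ne_zero _ hX0
    have hinvf' : invX (algebraMap (Polynomial F) (RatFunc F) fF) =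
        RatFunc.C ((-1) ^ (k₁ + 1)) * algebraMap (Polynomial F) (RatFunc F) fF / RatFunc.X ^ (f * (k₁ + 1)) := by
      rw [eq_div_iff hXN, hinvf]
    have hinvg' : invX (algebraMap (Polynomial F) (RatFunc F) gF) =
        (-1) ^ (k₁ + 1) * algebraMap (Polynomial F) (RatFunc F) gF / RatFunc.X ^ (f * (k₁ + 1)) := by
      rw [eq_div_iff hXN, hinvg]
    have hCn : RatFunc.C (((-1 : F)) ^ (k₁ + 1)) = (-1 : RatFunc F) ^ (k₁ + 1) := by
      rw [map_pow, map_neg, map_one]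
    have halgf : algebraMap (Polynomial F) (RatFunc F) fF ≠ 0 :=
      (map_ne_zero_iff _ (IsFractionRing.injective (Polynomial F) (RatFunc F))).mpr hfF0
    have halgg : algebraMap (Polynomial F) (RatFunc F) gF ≠ 0 :=
      (map_ne_zero_iff _ (IsFractionRing.injective (Polynomial F) (RatFunc F))).mpr hgF0
    have hm1 : ((-1 : RatFunc F)) ^ (k₁ + 1) ≠ 0 := pow_ne_zero _ (neg_ne_zero.mpr one_ne_zero)
    have hr : invX (algebraMap (Polynomial F) (RatFunc F) fF / algebraMap (Polynomial F) (RatFunc F) gF) =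
        algebraMap (Polynomial F) (RatFunc F) fF / algebraMap (Polynomial F) (RatFunc F) gF := by
      rw [map_div₀, hinvf', hinvg', hCn]
      field_simp
    have h2k : (2 : IsLocalRing.ResidueField O) ≠ 0 := fun h ↦ hp2
      ((Nat.prime_dvd_prime_iff_eq hp.out Nat.prime_two).mp
        ((CharP.cast_eq_zero_iff (IsLocalRing.ResidueField O) p 2).mp (by exact_mod_cast h)))
    have h2F : (2 : F) ≠ 0 := fun h ↦ h2k (by
      have := congrArg (algebraMap F (IsLocalRing.ResidueField O)) h
      rwa [map_ofNat, map_zero] at this)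
    have h2R : (2 : RatFunc F) ≠ 0 := fun h ↦ h2F (by
      have : algebraMap F (RatFunc F) 2 = algebraMap F (RatFunc F) 0 := by rw [map_ofNat, map_zero, h]
      exact (algebraMap F (RatFunc F)).injective this)
    rw [hr, ← two_mul]
    exact mul_ne_zero h2R (div_ne_zero halgf halgg)
  -- Sinnott's Theorem 3.2
  obtain ⟨m₀, hm₀⟩ := sinnott_sum_psi_ratFn_ne_zero (E := IsLocalRing.ResidueField O) hMp hqdef hq hFq
    hn₀def.symm ε₁ hε₁ fF hgF0 hsupp hN
  -- the bound `r₀`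
  refine ⟨max m₀ (max f 2), fun r hr φ hφ hK1 hK2 ↦ ?_⟩
  have hrm : m₀ ≤ r := le_trans (le_max_left _ _) hr
  have hrf : f ≤ r := le_trans (le_trans (le_max_left _ _) (le_max_right _ _)) hr
  have hr2 : 2 ≤ r := le_trans (le_trans (le_max_right _ _) (le_max_right _ _)) hr
  have hdr : depth M ≤ r := le_trans (by unfold depth; split_ifs <;> omega) hr2
  haveI : NeZero (f * M ^ r) := ⟨mul_ne_zero hf0 (pow_ne_zero _ hM.out.ne_zero)⟩
  have hMrf : ¬ M ^ r ∣ f := fun h ↦ by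
    have h1 : f < M ^ r := lt_of_le_of_lt hrf
      (lt_of_lt_of_le r.lt_two_pow_self (Nat.pow_le_pow_left hM.out.two_le r))
    exact absurd (Nat.le_of_dvd (Nat.pos_of_ne_zero hf0) h) (not_le.mpr h1)
  obtain ⟨ζ, hζ⟩ := hroots (M ^ r) (pow_pos hM.out.pos r)
  have hB := gaussSum_mul_generalizedBernoulli θ hφ hζ hMrf hn
  rw [Nat.add_sub_cancel] at hB
  -- (i) the Gauss sum is a unit
  have he1 : ∀ a : ZMod (M ^ r), v (AddChar.zmodChar (M ^ r) hζ.pow_eq_one a) ≤ 1 := fun a ↦ by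
    rw [AddChar.zmodChar_apply]
    refine le_of_eq (valuation_eq_one_of_pow_eq_one v (pow_ne_zero r hM.out.ne_zero) ?_)
    rw [← pow_mul, mul_comm, pow_mul, hζ.pow_eq_one, one_pow]
  have hvg : v (gaussSum φ (AddChar.zmodChar (M ^ r) hζ.pow_eq_one)) = 1 := by
    have hprod := gaussSum_mul_gaussSum_inv_eq_natCast hφ (AddChar.zmodChar_primitive_of_primitive_root (M ^ r) hζ)
    have hvMr : v ((M ^ r : ℕ) : K) = 1 := valuation_eq_one_of_coprime v hvp
      (Nat.Coprime.pow_left r ((Nat.coprime_primes hM.out hp.out).mpr hMp))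
    have hle1 : v (gaussSum φ (AddChar.zmodChar (M ^ r) hζ.pow_eq_one)) ≤ 1 :=
      v.map_sum_le fun a _ ↦ by
        rw [map_mul]; exact mul_le_one' (valuation_apply_le_one v φ a) (he1 a)
    have hle2 : v (gaussSum φ⁻¹ (AddChar.zmodChar (M ^ r) hζ.pow_eq_one)⁻¹) ≤ 1 :=
      v.map_sum_le fun a _ ↦ by
        rw [map_mul, AddChar.inv_apply]
        exact mul_le_one' (valuation_apply_le_one v φ⁻¹ a) (he1 (-a))
    have hv := congrArg v hprod
    rw [map_mul, Nat.cast_pow, ← Nat.cast_pow, hvMr] at hv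
    refine le_antisymm hle1 (not_lt.mp fun hlt ↦ ?_)
    exact (mul_lt_one_of_nonneg_of_lt_one_left zero_le hlt hle2).ne hv
  -- (ii) the sum `S = ∑_b φ(b) Q(ζ^b)/((ζ^b)^f-1)^n` is integral; its reduction is Sinnott's sum
  -- the character `ψ' = φ mod 𝔪` on units
  have hφv : ∀ b : (ZMod (M ^ r))ˣ, v (φ b) = 1 := fun b ↦
    valuation_eq_one_of_pow_eq_one v Fintype.card_ne_zero (apply_pow_card_eq_one φ b)
  set φO : (ZMod (M ^ r))ˣ → O := fun b ↦ ⟨φ b, (hφv b).le⟩ with hφOdef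
  have hφOK : ∀ b, ((φO b : O) : K) = φ b := fun b ↦ rfl
  have hφOu : ∀ b, IsUnit (φO b) := fun b ↦ (isUnit_iff_valuation_eq_one v _).mpr (hφv b)
  have hφOmul : ∀ a b, φO (a * b) = φO a * φO b := fun a b ↦
    Subtype.ext (by rw [hφOK]; push_cast; rw [map_mul])
  set φU : (ZMod (M ^ r))ˣ →* Oˣ := MonoidHom.mk' (fun b ↦ (hφOu b).unit)
    (fun a b ↦ Units.ext (by rw [Units.val_mul, IsUnit.unit_spec, IsUnit.unit_spec, IsUnit.unit_spec,
      hφOmul])) with hφUdef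
  have hφU : ∀ b, ((φU b : Oˣ) : O) = φO b := fun b ↦ IsUnit.unit_spec _
  set ψ' : (ZMod (M ^ r))ˣ →* (IsLocalRing.ResidueField O)ˣ :=
    (Units.map (IsLocalRing.residue O : O →* IsLocalRing.ResidueField O)).comp φU with hψ'def
  have hψ'val : ∀ b, ((ψ' b : (IsLocalRing.ResidueField O)ˣ) : IsLocalRing.ResidueField O) =
      IsLocalRing.residue O (φO b) := fun b ↦ by
    rw [hψ'def, MonoidHom.comp_apply, Units.coe_map, hφU]; rfl
  have hK1' : ∀ u, IsTors u → ψ' u = 1 := fun u hu ↦ by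
    apply Units.ext
    rw [hψ'val, Units.val_one, ← map_one (IsLocalRing.residue O)]
    congr 1
    exact Subtype.ext (by rw [hφOK, hK1 u hu]; rfl)
  have hK2' : ∀ u, ψ' u = 1 → IsTors u := fun u hu ↦ by
    apply hK2
    have h1 : IsLocalRing.residue O (φO u) = 1 := by rw [← hψ'val, hu, Units.val_one]
    have hpow : (φO u) ^ (M ^ (r - depth M)) = 1 := Subtype.ext (by
      rw [SubmonoidClass.coe_pow, hφOK, OneMemClass.coe_one, ← map_pow, ← Units.val_pow_eq_pow_val,
        hK1 _ (isTors_pow_pow_sub_depth hdr u)])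
    have h2 := eq_one_of_pow_eq_one_of_residue v (hMpowk _) hpow h1
    rw [← hφOK, h2]; rfl
  -- `ζ` in `O` and in the residue field
  have hζv : v ζ = 1 := valuation_eq_one_of_pow_eq_one v (pow_ne_zero _ hM.out.ne_zero) hζ.pow_eq_one
  set ζO : O := ⟨ζ, hζv.le⟩ with hζOdef
  have hζOK : ((ζO : O) : K) = ζ := rfl
  have hζO : IsPrimitiveRoot ζO (M ^ r) :=
    IsPrimitiveRoot.of_map_of_injective (f := algebraMap O K) (by exact hζ) (IsFractionRing.injective O K)
  set ζk := IsLocalRing.residue O ζO with hζkdef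
  have hζk : IsPrimitiveRoot ζk (M ^ r) := isPrimitiveRoot_residue v hMk (by omega) hζO
  -- the units `(ζ^b)^f - 1`
  have hub : ∀ b : (ZMod (M ^ r))ˣ, IsUnit ((ζO ^ (b : ZMod (M ^ r)).val) ^ f - 1) := by
    intro b
    refine isUnit_sub_one_of_pow_eq_one v (N := M ^ r) (hMpowk r) ?_ ?_
    · rw [← pow_mul, ← pow_mul, ← mul_assoc, mul_comm _ (M ^ r), pow_mul, hζO.pow_eq_one, one_pow]
    · intro h
      have h' : (ζ ^ (b : ZMod (M ^ r)).val) ^ f = 1 := by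
        have := congrArg (algebraMap O K) h
        rwa [map_pow, map_pow, map_one] at this
      rw [← pow_mul, hζ.pow_eq_one_iff_dvd] at h'
      have hcop : ((b : ZMod (M ^ r)).val).Coprime (M ^ r) := by
        rw [← ZMod.isUnit_iff_coprime, ZMod.natCast_zmod_val]; exact b.isUnit
      exact hMrf (hcop.symm.dvd_of_dvd_mul_left h')
  -- the numerator polynomial over `O`
  set QO : Polynomial O := qpoly (fun c ↦ aO c) f k₁ with hQOdef
  have hQOK : QO.map (algebraMap O K) = qpoly (fun c ↦ θ (c : ZMod f)) f k₁ := by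
    rw [hQOdef, qpoly_map]
    congr 1
  have hQOk : QO.map (IsLocalRing.residue O) = fF.map (algebraMap F (IsLocalRing.ResidueField O)) := by
    rw [hQOdef, hfFdef, qpoly_map, qpoly_map]
    congr 1
  -- the integral element `S_O`
  set SO : O := ∑ b : (ZMod (M ^ r))ˣ, φO b * (QO.eval (ζO ^ (b : ZMod (M ^ r)).val) *
    (((hub b).unit⁻¹ : Oˣ) : O) ^ (k₁ + 1)) with hSOdef
  have hSOK : (SO : K) = ∑ b : (ZMod (M ^ r))ˣ, φ b *
      ((qpoly (fun c ↦ θ (c : ZMod f)) f k₁).eval (ζ ^ (b : ZMod (M ^ r)).val) /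
        ((ζ ^ (b : ZMod (M ^ r)).val) ^ f - 1) ^ (k₁ + 1)) := by
    show algebraMap O K SO = _
    rw [hSOdef, map_sum]
    refine sum_congr rfl fun b _ ↦ ?_
    rw [map_mul, map_mul, map_pow, map_units_inv, IsUnit.unit_spec, map_sub, map_one, map_pow, map_pow,
      ← Polynomial.eval₂_at_apply, Polynomial.eval₂_eq_eval_map, hQOK, map_pow]
    rw [ValuationSubring.algebraMap_apply, ValuationSubring.algebraMap_apply, hφOK, hζOK, div_eq_mul_inv,
      inv_pow]
  have hSOk : IsLocalRing.residue O SO = ∑ c : (ZMod (M ^ r))ˣ,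
      ((ψ' c : (IsLocalRing.ResidueField O)ˣ) : IsLocalRing.ResidueField O) *
        ratFn fF gF (pw ζk (c : ZMod (M ^ r))) := by
    rw [hSOdef, map_sum]
    refine sum_congr rfl fun b _ ↦ ?_
    rw [map_mul, map_mul, map_pow, map_units_inv, IsUnit.unit_spec, map_sub, map_one, map_pow, map_pow,
      ← Polynomial.eval₂_at_apply, Polynomial.eval₂_eq_eval_map, hQOk, map_pow, hψ'val, ratFn_def,
      Polynomial.eval₂_eq_eval_map, pw_def, ← hζkdef, hgFdef, Polynomial.eval₂_pow, Polynomial.eval₂_sub,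
      Polynomial.eval₂_X_pow, Polynomial.eval₂_one, div_eq_mul_inv, inv_pow]
  have hSOne : IsLocalRing.residue O SO ≠ 0 := by
    rw [hSOk]
    exact hm₀ r hrm ζk hζk ψ' hK1' hK2'
  have hvS : v (SO : K) = 1 :=
    (isUnit_iff_valuation_eq_one v SO).mp ((IsLocalRing.residue_ne_zero_iff_isUnit _).mp hSOne)
  -- conclusion: `g B = n S`, `v(g) = v(S) = 1`
  rw [← hSOK] at hB
  have hn0 : ((k₁ + 1 : ℕ) : K) ≠ 0 := Nat.cast_ne_zero.mpr (by omega)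
  have hg0 : gaussSum φ (AddChar.zmodChar (M ^ r) hζ.pow_eq_one) ≠ 0 := fun h ↦ by
    rw [h, map_zero] at hvg; exact zero_ne_one hvg
  have hBS : generalizedBernoulli (k₁ + 1) (DirichletCharacter.changeLevel (dvd_mul_right f (M ^ r)) θ *
      DirichletCharacter.changeLevel (dvd_mul_left (M ^ r) f) φ⁻¹) / ((k₁ + 1 : ℕ) : K) =
        (SO : K) / gaussSum φ (AddChar.zmodChar (M ^ r) hζ.pow_eq_one) := by
    rw [div_eq_div_iff hn0 hg0, mul_comm, hB, mul_comm]
  rw [hBS, map_div₀, hvS, hvg, div_one]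

end Main


end Literature.NumberTheory.LFunctions
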